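import Summits.HodgeConjecture.HodgeConjecture.Theorems.R90S6MacdonaldClosedFormU2        -- ★ F2′-U2 (p03): `smul_orbitSum_eq_satakeTransform_sub_two` (inverse expansion), `line_two_zero`, `single_line_two_zero`
import Summits.HodgeConjecture.HodgeConjecture.Theorems.R90S6SatakeCoeffEtaOnePartner      -- ★ TE3 (p04): `coeff_satakeTransform_etaOneGraphPartner` (brings ★ W10 `etaOneGraphPartnerAlgHom`, ★ B3, ★ rank-one letters)
import Literature.NumberTheory.Automorphic.UnitaryRankOneSatakeClassical                    -- ★ `coeff_satakeTransform_neg_two` (`W`-symmetry of `𝒮` on `U(1,1)`)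
import HarnessLib

/-!
# R90 · S6 «Ch. 14.1–14.5 stable trace formula» — card TE4 (row E1.4.4.3.1): `η̂₁(φ)` ON THE `U(1,1)` CARTAN BASIS — the INVERSE SATAKE on the rank-one side
# `f = Σ_{k ≤ N} e_k(f) • φ′_k`, `e_k = q^{−k} a_k − (q − 1) Σ_{k < j ≤ N} q^{−j} a_j`, `a_j = (𝒮f)_{ℓ′_j}` (`Theorems/R90S6EtaOnePartnerOnBasis.lean`)

Cell `hodgecm-mathlib`, crux H413 (`stmt-HodgeConjecture-24833`), route of record `HCCMUnconditional`; programme R90-TF (brief `director/R90-BRIEF.v2.md`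
1f40d54518340a35), section S6 (base `R90-C14`, dealer R90-C14-plan (g2)), seat R90-C14-p04 (g2); CARD TE4 dealt BY NAME 2026-09-05T01:56:15Z (R90 bus).  Lane
`--kind proof --supports stmt-HodgeConjecture-24833 --as helper`; THEOREMS ONLY over ★ carriers (no definition, no instance, no notation, no named fact, no kit, no `sorry`).

## THE MATHEMATICS (Macdonald 1971 Ch. V §3; Cartier 1979 §IV Thm. 4.1)
`ℋ(U(1,1)(K), K₀)` has the Cartan basis `φ′_k = 1_{K₀ t^k K₀}` (`t = diag(ϖ, ϖ⁻¹)`, `k ≥ 0`); its Satake transform is lower-triangular in the `W`-orbit sums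
`σ_j = x^{ℓ′_j} + x^{ℓ′_{−j}}` of the line `ℓ′_j = (j, −j)`: ★ F2′-U2 `smul_orbitSum_eq_satakeTransform_sub_two` (p03) — `q^j σ_j = 𝒮(φ′_j) − (q − 1) Σ_{i<j} 𝒮(φ′_i)`,
`q = q_v = √#𝓀`.  Hence every `f ∈ ℋ` whose Satake transform is supported on `{ℓ′_m : |m| ≤ N}` (it is always supported on the line and `W`-symmetric: ★
`coeff_satakeTransform_eq_zero_of_ne_neg`, ★ `coeff_satakeTransform_neg_two`) satisfies `𝒮f = a_0 + Σ_{1 ≤ j ≤ N} a_j σ_j`, `a_j = (𝒮f)_{ℓ′_j}`, and back-substitution gives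
the EXPANSION ON THE CARTAN BASIS `f = Σ_{k ≤ N} e_k φ′_k`, `e_k = q^{−k} a_k − (q − 1) Σ_{k < j ≤ N} q^{−j} a_j` (★ `satakeTransform_injective`).  For `f = η̂₁(φ)` the `a_j` are the
NORM-FIBRE SUMS of the `GL₃` Satake coefficients of `φ` (★ TE3), which is what `SO^H(η̂₁ φ_λ)` in row E1.4.4.3.1 evaluates basis element by basis element.
[Rogawski1990, §4.10 Prop. 4.10.1 (b) p. 58: the Hecke clause `φ^H = η̂₁(φ)`.]

## WHAT IS PROVED
* §1 (abstract back-substitution, any `ℂ`-module): **`sum_smul_eq_sum_smul_of_triangular`** — if `q ≠ 0` and `q^j • y_j = s_j − (q−1) • Σ_{i<j} s_i` for all `j`, then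
  `Σ_{j ≤ N} a_j • y_j = Σ_{k ≤ N} (q^{−k} a_k − (q−1) Σ_{k<j≤N} q^{−j} a_j) • s_k` (induction on `N`).
* §2 (generic `U(1,1)`: `hd : UnramifiedLocalConjDatum σ ϖ`, `σ ≠ id`, `t` with matrix `diag(ϖ, ϖ⁻¹)` — ★ F2′-U2's binders VERBATIM):
  **`satakeTransform_eq_sum_coeff_smul_orbitSum_two`** — the line expansion `𝒮f = a_0 • 1 + Σ_{j<N} a_{j+1} • σ_{j+1}` under the support bound `hN`, and the GENERIC HEAD
  **`eq_sum_smul_doubleCosetOperator_pow_of_coeff_two`** — `f = Σ_{k ≤ N} e_k • φ′_k` with `e_k` as above (`q⁻¹ ^ k`, `Finset.Ioc k N`).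
* §3 (adic place; ★ W10 ∕ TE3 binders VERBATIM): **`etaOneGraphPartner_eq_sum_smul_doubleCosetOperator_pow`** — the `η̂₁` edition: for `φ ∈ ℋ(GL₃(K′), GL₃(𝒪))` with
  `GL`-Satake support bound `|μ₀ − μ₂| ≤ N`, `η̂₁ φ = Σ_{k ≤ N} e_k • φ′_k` with every `a_j` REPLACED by the norm-fibre sum `Σ_{μ₀−μ₂ = j} (𝒮^{GL}_{wt} φ)_μ` (UNSIGNED, R2); the `c_λ`
  edition of the card is this theorem at `φ := c_λ` (a specialisation by name, not a separate declaration).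
HONEST LABEL: local Hecke-algebra inversion over ★ carriers; proves no printed global statement and no orbital-integral identity, discharges no citation; count-neutral helper
until row E1.4.4.3.1 ∕ W10-j consume it.  HC_CM is proved only modulo the 7 printed citations (2 remaining named inputs: hLiu418 = stmt-HodgeConjecture-24832,
h413 = stmt-HodgeConjecture-24833) until rung 0 closes; REL ≠ ★ ≠ BUILT.

## Tree search (dedup)
`rg "EtaOnePartnerOnBasis|sum_smul_eq_sum_smul_of_triangular|satakeTransform_eq_sum_coeff_smul_orbitSum|eq_sum_smul_doubleCosetOperator_pow_of_coeff|etaOneGraphPartner_eq_sum_smul"` over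
`lean/` — no hit (2026-09-05T02:09Z); REUSED ★: `smul_orbitSum_eq_satakeTransform_sub_two`, `line_two_zero`, `single_line_two_zero` [R90S6MacdonaldClosedFormU2], `coeff_satakeTransform_neg_two`
[UnitaryRankOneSatakeClassical :202], `coeff_satakeTransform_eq_zero_of_ne_neg`, `eq_linear_two_of_rev`, `rev_linear_two`, `satakeTransform_injective`, TE3
`coeff_satakeTransform_etaOneGraphPartner`; nearest (other normalisation): ★ `HyperspecialUnitarySatakeOrbitSumBasis` (counting transform `𝒮_1`, twisted orbit sums), ★ H1 §3
`eq_sum_xiHCoeff_smul_of_step` (the `ξ̂_H`-specific telescoping solver — not this inversion).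

## References
* [Macdonald1971] I. G. Macdonald, *Spherical functions on a group of p-adic type*, Ramanujan Inst. Publ. 2 (1971): Ch. V §3.
* [CartierCorvallis1979] P. Cartier, *Representations of 𝔭-adic groups: a survey*, PSPM 33.1 (1979): §IV (4.2), Thm. 4.1, Cor. 4.2.
* [Rogawski1990] J. D. Rogawski, *Automorphic Representations of Unitary Groups in Three Variables*, Ann. of Math. Stud. 123 (1990): §4.10 Prop. 4.10.1 (b) p. 58.
-/

set_option autoImplicit false
-- the mandated namespace repeats the single-problem summit's segment (`HodgeConjecture.HodgeConjecture`)
set_option linter.dupNamespace false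

noncomputable section

open scoped Valued WithZero Matrix MatrixGroups
open NumberField IsDedekindDomain
open Literature.NumberTheory.Automorphic Literature.NumberTheory.Automorphic.HermitianLattice Literature.NumberTheory.Automorphic.UnitaryGroup
  Literature.NumberTheory.Automorphic.HermitianLattice.UnramifiedLocalConjDatum Literature.NumberTheory.Automorphic.heckeAlgebra

namespace Summit.HodgeConjecture.HodgeConjecture.R90.S6

universe u

/-! ## §1 Abstract back-substitution for a unitriangular system `q^j y_j = s_j − (q−1) Σ_{i<j} s_i` -/

section Abstract

/-- **BACK-SUBSTITUTION.**  In a `ℂ`-module, if `q ≠ 0` and `q^j • y_j = s_j − (q − 1) • Σ_{i<j} s_i` for every `j` (Macdonald's inverse expansion on the `(q+1)`-regular tree,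
★ `smul_orbitSum_eq_satakeTransform_sub_two` with `y_j = σ_j`, `s_j = 𝒮(φ′_j)`), then for all coefficients `a` and every `N`:
`Σ_{j ≤ N} a_j • y_j = Σ_{k ≤ N} (q^{−k} a_k − (q − 1) Σ_{k < j ≤ N} q^{−j} a_j) • s_k`. [cite: Macdonald1971, Ch. V §3] [cite: CartierCorvallis1979, §IV Thm. 4.1] -/
theorem sum_smul_eq_sum_smul_of_triangular {M : Type*} [AddCommGroup M] [Module ℂ M] (q : ℂ) (hq : q ≠ 0) (s y : ℕ → M)
    (hy : ∀ j, q ^ j • y j = s j - (q - 1) • ∑ i ∈ Finset.range j, s i) (a : ℕ → ℂ) (N : ℕ) :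
    ∑ j ∈ Finset.range (N + 1), a j • y j =
      ∑ k ∈ Finset.range (N + 1), (q⁻¹ ^ k * a k - (q - 1) * ∑ j ∈ Finset.Ioc k N, q⁻¹ ^ j * a j) • s k := by
  have hy' : ∀ j, y j = q⁻¹ ^ j • (s j - (q - 1) • ∑ i ∈ Finset.range j, s i) := by
    intro j
    rw [← hy j, smul_smul, ← mul_pow, inv_mul_cancel₀ hq, one_pow, one_smul]
  induction N with
  | zero =>
    rw [zero_add, Finset.sum_range_one, Finset.sum_range_one, hy' 0, Finset.sum_range_zero, smul_zero, sub_zero, pow_zero, one_smul,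
      Finset.Ioc_self, Finset.sum_empty, mul_zero, sub_zero, one_mul]
  | succ N ih =>
    rw [Finset.sum_range_succ, ih, hy' (N + 1), Finset.sum_range_succ _ (N + 1)]
    have hIoc : ∀ k ∈ Finset.range (N + 1),
        (q⁻¹ ^ k * a k - (q - 1) * ∑ j ∈ Finset.Ioc k (N + 1), q⁻¹ ^ j * a j) • s k =
          (q⁻¹ ^ k * a k - (q - 1) * ∑ j ∈ Finset.Ioc k N, q⁻¹ ^ j * a j) • s k - ((q - 1) * (q⁻¹ ^ (N + 1) * a (N + 1))) • s k := by
      intro k hk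
      rw [Finset.mem_range] at hk
      rw [Finset.sum_Ioc_succ_top (show k ≤ N by omega), mul_add, ← sub_sub, sub_smul]
    rw [Finset.sum_congr rfl hIoc, Finset.sum_sub_distrib, Finset.Ioc_self, Finset.sum_empty, mul_zero, sub_zero,
      smul_smul, smul_sub, smul_smul, Finset.smul_sum]
    have e1 : ∀ k ∈ Finset.range (N + 1), ((q - 1) * (q⁻¹ ^ (N + 1) * a (N + 1))) • s k = (a (N + 1) * q⁻¹ ^ (N + 1) * (q - 1)) • s k :=
      fun k _ => by ring_nf
    have e2 : (q⁻¹ ^ (N + 1) * a (N + 1)) • s (N + 1) = (a (N + 1) * q⁻¹ ^ (N + 1)) • s (N + 1) := by rw [mul_comm]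
    rw [Finset.sum_congr rfl e1, e2]
    abel

end Abstract

/-! ## §2 Generic `U(1,1)`: the line expansion of `𝒮f` and the expansion of `f` on the Cartan basis -/

section Generic

variable {K : Type*} [Field K] [Valued K ℤᵐ⁰] {σ : K →+* K} {ϖ : K} [Finite 𝓀[K]]
  [IsHeckeTriple (⊤ : Submonoid (unitaryGroupOfForm σ ((StdForm.antidiagonal 2).over K))) (unitaryInt σ ((StdForm.antidiagonal 2).over K))
    (unitaryInt σ ((StdForm.antidiagonal 2).over K))]

/-- **THE LINE EXPANSION OF A SATAKE TRANSFORM ON `U(1,1)`**: if the Satake transform of `f ∈ ℋ(U(1,1)(K), K₀)` has no coefficient beyond `|m| > N` on the line, then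
`𝒮f = a_0 • 1 + Σ_{j < N} a_{j+1} • (x^{ℓ′_{j+1}} + x^{ℓ′_{−(j+1)}})`, `a_m = (𝒮f)_{ℓ′_m}` — support on the line (★ `coeff_satakeTransform_eq_zero_of_ne_neg`, ★ `eq_linear_two_of_rev`) and
`W`-symmetry `(𝒮f)_{−μ} = (𝒮f)_μ` (★ `coeff_satakeTransform_neg_two`). [cite: CartierCorvallis1979, §IV (4.2), Thm. 4.1] -/
theorem satakeTransform_eq_sum_coeff_smul_orbitSum_two (hd : UnramifiedLocalConjDatum σ ϖ) (hσ : ∃ x : K, σ x ≠ x)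
    (f : heckeAlgebra ℂ (unitaryGroupOfForm σ ((StdForm.antidiagonal 2).over K)) (unitaryInt σ ((StdForm.antidiagonal 2).over K))) (N : ℕ)
    (hN : ∀ μ : Fin 2 → ℤ, (N : ℤ) < |μ 0| → (hd.satakeTransform f).coeff μ = 0) :
    hd.satakeTransform f =
      (hd.satakeTransform f).coeff 0 • (1 : AddMonoidAlgebra ℂ (Fin 2 → ℤ)) +
        ∑ j ∈ Finset.range N, (hd.satakeTransform f).coeff (fun i : Fin 2 => ((j : ℤ) + 1) * (1 - 2 * ((i : ℕ) : ℤ))) •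
          (AddMonoidAlgebra.single (fun i : Fin 2 => ((j : ℤ) + 1) * (1 - 2 * ((i : ℕ) : ℤ))) (1 : ℂ) +
            AddMonoidAlgebra.single (fun i : Fin 2 => (-((j : ℤ) + 1)) * (1 - 2 * ((i : ℕ) : ℤ))) (1 : ℂ)) := by
  classical
  set F := hd.satakeTransform f with hF
  have hline0 : ∀ m : ℤ, (fun i : Fin 2 => m * (1 - 2 * ((i : ℕ) : ℤ))) 0 = m := fun m => by simp
  refine AddMonoidAlgebra.coeff_injective (Finsupp.ext fun μ => ?_)
  simp only [AddMonoidAlgebra.coeff_add, AddMonoidAlgebra.coeff_sum, AddMonoidAlgebra.coeff_smul, AddMonoidAlgebra.one_def, AddMonoidAlgebra.coeff_single,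
    Finsupp.add_apply, Finsupp.finsetSum_apply, Finsupp.smul_apply, Finsupp.single_apply, smul_eq_mul]
  by_cases hanti : ∀ i, μ (Fin.rev i) = -μ i
  · -- on the line: `μ = ℓ′_{m₀}`
    have hμ : μ = fun i : Fin 2 => μ 0 * (1 - 2 * ((i : ℕ) : ℤ)) := eq_linear_two_of_rev μ hanti
    set m₀ := μ 0 with hm₀
    have hind : ∀ m : ℤ, ((fun i : Fin 2 => m * (1 - 2 * ((i : ℕ) : ℤ))) = μ) ↔ m = m₀ := by
      intro m
      constructor
      · intro h
        have := congrFun h 0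
        simpa using this
      · rintro rfl
        exact hμ.symm
    have hind0 : ((0 : Fin 2 → ℤ) = μ) ↔ (0 : ℤ) = m₀ := by
      rw [← hind 0, line_two_zero]
    simp only [hind, hind0]
    rcases lt_trichotomy m₀ 0 with hneg | hzero | hpos
    · -- `m₀ < 0`: only the negative single with `j + 1 = −m₀` can fire
      rw [if_neg (by omega), mul_zero, zero_add]
      by_cases hle : -m₀ ≤ (N : ℤ)
      · rw [Finset.sum_eq_single_of_mem (-m₀ - 1).toNat (Finset.mem_range.2 (by omega))]
        · have hcast : (((-m₀ - 1).toNat : ℕ) : ℤ) + 1 = -m₀ := by omega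
          rw [hcast, if_neg (by omega), if_pos (by omega), zero_add, mul_one, hμ,
            show (fun i : Fin 2 => m₀ * (1 - 2 * ((i : ℕ) : ℤ))) = -(fun i : Fin 2 => -m₀ * (1 - 2 * ((i : ℕ) : ℤ))) from by
              funext i; simp only [Pi.neg_apply]; ring,
            hF, hd.coeff_satakeTransform_neg_two hσ]
        · intro j _ hj
          rw [if_neg (by omega), if_neg (by omega), add_zero, mul_zero]
      · rw [Finset.sum_eq_zero fun j hj => by
            rw [Finset.mem_range] at hj
            rw [if_neg (by omega), if_neg (by omega), add_zero, mul_zero]]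
        rw [hμ]
        exact hN _ (by simp only [Fin.isValue, Fin.val_zero, Nat.cast_zero, mul_zero, sub_zero, mul_one]; rw [abs_of_neg hneg]; omega)
    · -- `m₀ = 0`
      rw [if_pos hzero.symm, mul_one, Finset.sum_eq_zero fun j hj => by
            rw [if_neg (by omega), if_neg (by omega), add_zero, mul_zero], add_zero, hμ, hzero, line_two_zero]
    · -- `m₀ > 0`: only the positive single with `j + 1 = m₀` can fire
      rw [if_neg (by omega), mul_zero, zero_add]
      by_cases hle : m₀ ≤ (N : ℤ)
      · rw [Finset.sum_eq_single_of_mem (m₀ - 1).toNat (Finset.mem_range.2 (by omega))]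
        · have hcast : (((m₀ - 1).toNat : ℕ) : ℤ) + 1 = m₀ := by omega
          rw [hcast, if_pos rfl, if_neg (by omega), add_zero, mul_one, hμ]
        · intro j _ hj
          rw [if_neg (by omega), if_neg (by omega), add_zero, mul_zero]
      · rw [Finset.sum_eq_zero fun j hj => by
            rw [Finset.mem_range] at hj
            rw [if_neg (by omega), if_neg (by omega), add_zero, mul_zero]]
        rw [hμ]
        exact hN _ (by simp only [Fin.isValue, Fin.val_zero, Nat.cast_zero, mul_zero, sub_zero, mul_one]; rw [abs_of_pos hpos]; omega)
  · -- off the line: everything vanishes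
    obtain ⟨i, hi⟩ := not_forall.1 hanti
    have h0 : F.coeff μ = 0 := hd.coeff_satakeTransform_eq_zero_of_ne_neg f hi
    have hne : ∀ m : ℤ, ¬ ((fun i : Fin 2 => m * (1 - 2 * ((i : ℕ) : ℤ))) = μ) := by
      intro m h
      exact hanti fun k => by rw [← h]; exact rev_linear_two m k
    have hne0 : ¬ ((0 : Fin 2 → ℤ) = μ) := by rw [← line_two_zero]; exact hne 0
    simp only [hne, hne0, if_false, mul_zero, add_zero, Finset.sum_const_zero]
    exact h0

/-- **GENERIC HEAD — THE EXPANSION OF `f ∈ ℋ(U(1,1)(K), K₀)` ON THE CARTAN BASIS FROM ITS SATAKE LINE COEFFICIENTS.**  For `hd : UnramifiedLocalConjDatum σ ϖ` with `σ ≠ id`, `t` with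
matrix `diag(ϖ, ϖ⁻¹)` (★ F2′-U2's binders), `f ∈ ℋ` and a support bound `N` (`(𝒮f)_μ = 0` whenever `|μ 0| > N`):
`f = Σ_{k ≤ N} (q^{−k} a_k − (q − 1) Σ_{k < j ≤ N} q^{−j} a_j) • φ′_k`, `φ′_k = 1_{K₀ t^k K₀}`, `a_j = (𝒮f)_{ℓ′_j}`, `q = √#𝓀 = q_v` — the lower-triangular INVERSE of Macdonald's closed
form (★ `smul_orbitSum_eq_satakeTransform_sub_two`), through ★ `satakeTransform_injective`. [cite: Macdonald1971, Ch. V §3] [cite: CartierCorvallis1979, §IV Thm. 4.1] -/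
theorem eq_sum_smul_doubleCosetOperator_pow_of_coeff_two (hd : UnramifiedLocalConjDatum σ ϖ) (hσ : ∃ x : K, σ x ≠ x)
    (t : unitaryGroupOfForm σ ((StdForm.antidiagonal 2).over K)) (ht : (t : GL (Fin 2) K) = zpowDiagGL (CartanUnique.uniformizer_ne_zero hd.vϖ) ![(1 : ℤ), -1])
    (f : heckeAlgebra ℂ (unitaryGroupOfForm σ ((StdForm.antidiagonal 2).over K)) (unitaryInt σ ((StdForm.antidiagonal 2).over K))) (N : ℕ)
    (hN : ∀ μ : Fin 2 → ℤ, (N : ℤ) < |μ 0| → (hd.satakeTransform f).coeff μ = 0) :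
    f = ∑ k ∈ Finset.range (N + 1),
      ((Nat.sqrt (Nat.card 𝓀[K]) : ℂ)⁻¹ ^ k * (hd.satakeTransform f).coeff (fun i : Fin 2 => (k : ℤ) * (1 - 2 * ((i : ℕ) : ℤ))) -
          ((Nat.sqrt (Nat.card 𝓀[K]) : ℂ) - 1) *
            ∑ j ∈ Finset.Ioc k N, (Nat.sqrt (Nat.card 𝓀[K]) : ℂ)⁻¹ ^ j * (hd.satakeTransform f).coeff (fun i : Fin 2 => (j : ℤ) * (1 - 2 * ((i : ℕ) : ℤ)))) •
        doubleCosetOperator (unitaryInt σ ((StdForm.antidiagonal 2).over K)) (t ^ k) := by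
  classical
  set q : ℂ := (Nat.sqrt (Nat.card 𝓀[K]) : ℂ) with hq
  have hq0 : q ≠ 0 := by
    haveI : Nonempty 𝓀[K] := ⟨0⟩
    rw [hq, Nat.cast_ne_zero]
    exact (Nat.sqrt_pos.2 Nat.card_pos).ne'
  apply hd.satakeTransform_injective
  -- the Satake side: `s_k = 𝒮(φ′_k)`, `y_0 = 1`, `y_{j} = σ_j` (`j ≥ 1`)
  set s : ℕ → AddMonoidAlgebra ℂ (Fin 2 → ℤ) := fun k =>
    hd.satakeTransform (doubleCosetOperator (unitaryInt σ ((StdForm.antidiagonal 2).over K)) (t ^ k)) with hs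
  set y : ℕ → AddMonoidAlgebra ℂ (Fin 2 → ℤ) := fun j => q⁻¹ ^ j • (s j - (q - 1) • ∑ i ∈ Finset.range j, s i) with hy
  have hyj : ∀ j, q ^ j • y j = s j - (q - 1) • ∑ i ∈ Finset.range j, s i := by
    intro j
    rw [hy, smul_smul, ← mul_pow, mul_inv_cancel₀ hq0, one_pow, one_smul]
  -- `y_0 = 1` and `y_{j+1} = σ_{j+1}` (★ inverse expansion)
  have hy0 : y 0 = 1 := by
    rw [hy]
    simp only [pow_zero, Finset.sum_range_zero, smul_zero, sub_zero, one_smul, hs, doubleCosetOperator_one, map_one]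
  have hysucc : ∀ j : ℕ, y (j + 1) = AddMonoidAlgebra.single (fun i : Fin 2 => ((j : ℤ) + 1) * (1 - 2 * ((i : ℕ) : ℤ))) (1 : ℂ) +
      AddMonoidAlgebra.single (fun i : Fin 2 => (-((j : ℤ) + 1)) * (1 - 2 * ((i : ℕ) : ℤ))) (1 : ℂ) := by
    intro j
    have h := smul_orbitSum_eq_satakeTransform_sub_two hd hσ t ht (m := j + 1) (by omega)
    rw [Nat.cast_succ] at h
    have h' : q ^ (j + 1) • y (j + 1) = q ^ (j + 1) • (AddMonoidAlgebra.single (fun i : Fin 2 => ((j : ℤ) + 1) * (1 - 2 * ((i : ℕ) : ℤ))) (1 : ℂ) +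
        AddMonoidAlgebra.single (fun i : Fin 2 => (-((j : ℤ) + 1)) * (1 - 2 * ((i : ℕ) : ℤ))) (1 : ℂ)) := by
      rw [hyj, h]
    exact smul_right_injective _ (pow_ne_zero _ hq0) h'
  -- the line expansion of `𝒮f`, rewritten through `y`
  have hA := satakeTransform_eq_sum_coeff_smul_orbitSum_two hd hσ f N hN
  have hA' : hd.satakeTransform f = ∑ j ∈ Finset.range (N + 1),
      (hd.satakeTransform f).coeff (fun i : Fin 2 => (j : ℤ) * (1 - 2 * ((i : ℕ) : ℤ))) • y j := by
    rw [Finset.sum_range_succ', hy0, Nat.cast_zero, line_two_zero]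
    conv_lhs => rw [hA]
    rw [add_comm]
    congr 1
    refine Finset.sum_congr rfl fun j _ => ?_
    rw [hysucc j, Nat.cast_succ]
  rw [map_sum]
  conv_lhs => rw [hA', sum_smul_eq_sum_smul_of_triangular q hq0 s y hyj _ N]
  refine Finset.sum_congr rfl fun k _ => ?_
  rw [map_smul]

end Generic

/-! ## §3 The `η̂₁` edition at an inert unramified place -/

section Adic

variable {F E : Type} [Field F] [NumberField F] [Field E] [NumberField E] [Algebra F E] [Algebra.IsQuadraticExtension F E]
  (c : E ≃ₐ[F] E) (hc1 : c ≠ 1) (v : HeightOneSpectrum (𝓞 F)) (w : PlacesOver E v) (hw : c • w.1 = w.1)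
  (hv : Algebra.IsUnramifiedIn (𝓞 E) v.asIdeal)
  -- (the `GL₃`-side binders of ★ W10 ∕ TE3 VERBATIM up to notation: `𝒪[K]`, `𝓀[K]` of the `ValuativeRel` scope are spelled out, since this file also uses the
  --  `Valued` residue field `𝓀[E_w]` of the `U(1,1)` side and the two scoped notations would collide)
  {K : Type u} [Field K] [ValuativeRel K] [IsDiscreteValuationRing (ValuativeRel.valuation K).integer]
  [Finite (IsLocalRing.ResidueField (ValuativeRel.valuation K).integer)] {ϖ : K}
  [IsHeckeTriple (⊤ : Submonoid (GL (Fin 3) K)) (glInt 3 K) (glInt 3 K)]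
  (hϖ : IsUniformizingElement ϖ) {u : ℂˣ} (hu : (u : ℂ) ^ 2 = ((Nat.card (IsLocalRing.ResidueField (ValuativeRel.valuation K).integer) : ℕ) : ℂ))
  {wt : Multiplicative (Fin 3 → ℤ) →* ℂ}
  (hwt : ∀ e : Fin 3 → ℤ, wt (Multiplicative.ofAdd e) = ((u ^ ((((3 : ℕ) : ℤ) - 1) * (∑ i, e i) - 2 * satakeTwistExp e) : ℂˣ) : ℂ))

-- (raised heartbeat budget: the adic `heckeAlgebra` carrier at `E_w` vs the generic-`K` carrier of the ★ Satake files agree only up to instance-path unfolding; each such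
--  unification is costly — as in ★ W3-a, ★ B3, ★ TB3, ★ TE3; no `decide`, no search)
set_option maxHeartbeats 800000 in
/-- **TE4 HEAD — `η̂₁(φ)` ON THE `U(1,1)` CARTAN BASIS.**  At an inert place `w ∣ v` with `E_w∕F_v` unramified (`hd₂` any unramified datum at `w`, `σ_w ≠ id` by ★
`exists_galAdicCompletionMap_ne`, `t` with matrix `diag(ϖ_w, ϖ_w⁻¹)`), for every `φ ∈ ℋ(GL₃(K), GL₃(𝒪))` whose `GL`-Satake support has `|μ₀ − μ₂| ≤ N`:
`η̂₁ φ = Σ_{k ≤ N} (q^{−k} A_k − (q − 1) Σ_{k < j ≤ N} q^{−j} A_j) • φ′_k` with `A_j = Σ_{μ ∈ supp(𝒮^{GL}_{wt} φ), μ₀ − μ₂ = j} (𝒮^{GL}_{wt} φ)_μ` the NORM-FIBRE SUMS (★ TE3) — UNSIGNED; the `c_λ`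
edition of row E1.4.4.3.1 is this statement at `φ := c_λ`. [cite: Rogawski1990, §4.10 Prop. 4.10.1 (b) p. 58] [cite: Macdonald1971, Ch. V §3] [cite: CartierCorvallis1979, §IV Thm. 4.1] -/
theorem etaOneGraphPartner_eq_sum_smul_doubleCosetOperator_pow {ϖE : w.1.adicCompletion E}
    (hd₂ : UnramifiedLocalConjDatum (galAdicCompletionMap (L := E) c hw) ϖE)
    (t : unitaryGroupOfForm (galAdicCompletionMap (L := E) c hw) ((StdForm.antidiagonal 2).over (w.1.adicCompletion E)))
    (ht : (t : GL (Fin 2) (w.1.adicCompletion E)) = zpowDiagGL (CartanUnique.uniformizer_ne_zero hd₂.vϖ) ![(1 : ℤ), -1])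
    (φ : heckeAlgebra ℂ (GL (Fin 3) K) (glInt 3 K)) (N : ℕ)
    (hNφ : ∀ μ ∈ ((isIwasawaExponent_gl (n := 3) hϖ).satakeTransform wt φ).coeff.support, |μ 0 - μ 2| ≤ N) :
    haveI := finite_residueField_adicCompletion E w.1
    haveI := isHeckeTriple_unitaryInt_adicCompletion c v w hw ((StdForm.antidiagonal 2).over (w.1.adicCompletion E))
    etaOneGraphPartnerAlgHom c hc1 v w hw hv hϖ hu hwt φ =
      ∑ k ∈ Finset.range (N + 1),
        ((Nat.sqrt (Nat.card 𝓀[w.1.adicCompletion E]) : ℂ)⁻¹ ^ k *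
              (∑ μ ∈ ((isIwasawaExponent_gl (n := 3) hϖ).satakeTransform wt φ).coeff.support with μ 0 - μ 2 = (k : ℤ),
                ((isIwasawaExponent_gl (n := 3) hϖ).satakeTransform wt φ).coeff μ) -
            ((Nat.sqrt (Nat.card 𝓀[w.1.adicCompletion E]) : ℂ) - 1) *
              ∑ j ∈ Finset.Ioc k N, (Nat.sqrt (Nat.card 𝓀[w.1.adicCompletion E]) : ℂ)⁻¹ ^ j *
                (∑ μ ∈ ((isIwasawaExponent_gl (n := 3) hϖ).satakeTransform wt φ).coeff.support with μ 0 - μ 2 = (j : ℤ),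
                  ((isIwasawaExponent_gl (n := 3) hϖ).satakeTransform wt φ).coeff μ)) •
          doubleCosetOperator (unitaryInt (galAdicCompletionMap (L := E) c hw) ((StdForm.antidiagonal 2).over (w.1.adicCompletion E))) (t ^ k) := by
  classical
  haveI := finite_residueField_adicCompletion E w.1
  haveI := isHeckeTriple_unitaryInt_adicCompletion c v w hw ((StdForm.antidiagonal 2).over (w.1.adicCompletion E))
  have hσ : ∃ x : w.1.adicCompletion E, galAdicCompletionMap (L := E) c hw x ≠ x := exists_galAdicCompletionMap_ne c hc1 v w hw
  -- the support bound on the `U(1,1)` side from the `GL` side through ★ TE3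
  have hN : ∀ μ : Fin 2 → ℤ, (N : ℤ) < |μ 0| →
      (hd₂.satakeTransform (etaOneGraphPartnerAlgHom c hc1 v w hw hv hϖ hu hwt φ)).coeff μ = 0 := by
    intro μ hμ
    by_cases hanti : ∀ i, μ (Fin.rev i) = -μ i
    · rw [eq_linear_two_of_rev μ hanti, coeff_satakeTransform_etaOneGraphPartner c hc1 v w hw hv hϖ hu hwt hd₂ φ (μ 0)]
      refine Finset.sum_eq_zero fun ν hν => ?_
      rw [Finset.mem_filter] at hν
      have := hNφ ν hν.1
      rw [hν.2] at this
      omega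
    · obtain ⟨i, hi⟩ := not_forall.1 hanti
      exact hd₂.coeff_satakeTransform_eq_zero_of_ne_neg _ hi
  have h := eq_sum_smul_doubleCosetOperator_pow_of_coeff_two hd₂ hσ t ht (etaOneGraphPartnerAlgHom c hc1 v w hw hv hϖ hu hwt φ) N hN
  simp only [coeff_satakeTransform_etaOneGraphPartner c hc1 v w hw hv hϖ hu hwt hd₂ φ] at h
  exact h

end Adic

end Summit.HodgeConjecture.HodgeConjecture.R90.S6

end
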